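import Summits.CriticalPhenomena.PercolationContinuityZ3.Theorems.PercNearOneGluingNoHeavyLowerTailSahiGridPatternCellAtoms

/-!
# `NoHeavyLowerTail` (crux stmt-CriticalPhenomena-4575), Sahi programme P1: **THE TWO FIBRE IDENTITIES OF A JUNTA CYLINDER AND THE
# Θ-NONNEGATIVE LIFT** (every `k`, every `n`)

Support file (Sahi cell, seat `prim-sahi-p1`, generation 15; `--supports stmt-CriticalPhenomena-4575`).  Pure proofs, NO definitions, no `sorry`,
standard axioms.  Vocabulary of `…SahiGridPattern{CellForm,CellAtoms}`: `cylSet U = U × [3]^n` (`U ⊆ [3]^k` the cells), fibres / sections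
`sect B ξ = {q : glue ξ q ∈ B}`, cell statistics `cellT B C q r = 2^n·#(B_q ∩ C_r)`, `cellN B C q r = N(B_q;C_r)` (totally distinct pairs),
coefficients `lamU U q = λ_U(q) = 2^{k+1}1_U(q) − ν_U(q)`, `thetaVal U q r = Θ_U(q,r) = [q δ̸ r](1_U(q) + 1_U(r) − 1_U(q̄r))`.

THE MATHEMATICS.  Write `H[q|r] := cellT B C q r − cellN B C q r ≥ 0` (coefficientwise Harris on the fibre pair, `cellN_le_cellT`).  The cell
form `sStarD (cylSet U) B C = Σ_q λ_U(q)·cellT(q,q) − Σ_{q,r} Θ_U(q,r)·cellN(q,r)` (`sStarD_cylSet_eq`) and the slice form `β_U = diag(λ_U) − Θ_U`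
(`sliceForm_eq`) give two exact regroupings — the gen-10/11 memos' "same-fibre identity" and "block-cylinder / different-fibre identity",
there checked numerically, here theorems:
  (I)  `sStarD (cylSet U) B C = 2^n · Σ_ξ sStarD U B^ξ C^ξ + Σ_{q,r} Θ_U(q,r) · H[q|r]`            (`sStarD_cylSet_eq_sameFibre`),
  (II) `sStarD (cylSet U) B C = Σ_{ξ δ̸ η} sStarD U B^ξ C^η + Σ_q λ_U(q) · H[q|q]`                 (`sStarD_cylSet_eq_crossFibre`).
In (I) the only possibly negative coefficients are the pairs `q, r ∉ U` with `q̄r ∈ U` (`Θ = −1`); in (II) the cells `q ∉ U` (`λ = −ν_U(q)`).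
CONSEQUENCES (for a first slot `U` that is good in dimension `k`, i.e. `sStarD U X Y ≥ 0` for all up-sets `X, Y ⊆ [3]^k`):
* **Θ-NONNEGATIVE LIFT** (`sStarD_cylSet_nonneg_of_thetaVal_nonneg`, `sStarD_cylSet_nonneg_of_thirdClosed`): if no totally distinct pair
  outside `U` has its third point inside `U` (⟺ `Θ_U ≥ 0`), then `U × [3]^n` is a good first slot in EVERY dimension `n + k`.  With
  `PatternPos k` as the source of goodness: `sStarD_cylSet_nonneg_of_patternPos_of_thirdClosed`.  (For `k ≤ 2` the hypothesis forces a co-top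
  pattern; for `k = 3` it adds the eight 'majority' juntas `⊇ {x : ≥ 2 nonzero coordinates}` — subsumed by USD(3); for `k = 4` it is a new
  conditional face, e.g. `{x ∈ [3]^4 : at least two nonzero coordinates}`, whose complement contains no totally distinct pair.)
* QUANTITATIVE LOWER BOUNDS (`sStarD_cylSet_ge_thetaNeg`, `sStarD_cylSet_ge_lamNeg`): for every good `U` and all up-sets `B, C`,
  `sStarD (cylSet U) B C ≥ Σ_{Θ_U(q,r) < 0} Θ_U(q,r)·H[q|r]` and `≥ −Σ_{q ∉ U} ν_U(q)·H[q|q]` — a would-be violation of slot goodness in a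
  higher dimension must be paid ENTIRELY by the Harris slacks at the negative cells (for `U = V×V`, `V = [3]²∖{00}`: the 32 pairs `((00,y),(x′,00))`,
  `y, x′ ∈ {1,2}²`, resp. the 17 cells with a `00` block — the frame of the gen-15 analysis of the census' (†)₄ failures, memo
  `run/shared/lean/prim/prim-sahi/FROM-prim-sahi-p1-gen15-W53-AFTERMATH-REALISABLE-CONE.md`).
Nothing here asserts `PatternPos d` for `d ≥ 4`. [this work]
-/

namespace Summit.CriticalPhenomena.PercolationContinuityZ3.Theorems.SahiGridPattern

open Finset SahiGrid3
open scoped BigOperators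

variable {n k : ℕ}

/-! ### The slice form in cell coordinates -/

/-- `β_U(q,r) = tgtT U q r + tgtN U q r` (the slice form `sliceForm_eq`, restated with the cell-form coefficient matrices). [this work] -/
theorem sliceBeta_eq_tgtT_add_tgtN (U : Finset (Pd k)) (q r : Pd k) : sliceBeta U q r = tgtT U q r + tgtN U q r := by
  unfold sliceBeta tgtT tgtN lamU
  rw [sliceForm_eq]
  ring

/-! ### The two fibre identities -/

/-- **SAME-FIBRE IDENTITY** (every `k`, `n`): `sStarD (cylSet U) B C = 2^n Σ_ξ sStarD U B^ξ C^ξ + Σ_{q,r} Θ_U(q,r)·(cellT − cellN)(q,r)`.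
[this work] -/
theorem sStarD_cylSet_eq_sameFibre (U : Finset (Pd k)) (B C : Finset (Pd (n + k))) :
    sStarD (cylSet U : Finset (Pd (n + k))) B C =
      2 ^ n * (∑ ξ : Pd n, sStarD U (sect B ξ) (sect C ξ))
        + ∑ q : Pd k, ∑ r : Pd k, thetaVal U q r * (cellT B C q r - cellN B C q r) := by
  have hpt : ∀ q r : Pd k, tgtT U q r * cellT B C q r + tgtN U q r * cellN B C q r =
      sliceBeta U q r * cellT B C q r + thetaVal U q r * (cellT B C q r - cellN B C q r) := by
    intro q r; rw [sliceBeta_eq_tgtT_add_tgtN]; unfold tgtN; ring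
  rw [sStarD_cylSet_eq_pair, ← pairT_sliceBeta_eq]
  unfold pairT pairN
  rw [← Finset.sum_add_distrib, ← Finset.sum_add_distrib]
  refine Finset.sum_congr rfl fun q _ => ?_
  rw [← Finset.sum_add_distrib, ← Finset.sum_add_distrib]
  exact Finset.sum_congr rfl fun r _ => hpt q r

/-- **CROSS-FIBRE IDENTITY** (every `k`, `n`): `sStarD (cylSet U) B C = Σ_{ξ δ̸ η} sStarD U B^ξ C^η + Σ_q λ_U(q)·(cellT − cellN)(q,q)`.
[this work] -/
theorem sStarD_cylSet_eq_crossFibre (U : Finset (Pd k)) (B C : Finset (Pd (n + k))) :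
    sStarD (cylSet U : Finset (Pd (n + k))) B C =
      (∑ ξ : Pd n, ∑ η : Pd n, (if TotDist ξ η = true then (1:ℤ) else 0) * sStarD U (sect B ξ) (sect C η))
        + ∑ q : Pd k, lamU U q * (cellT B C q q - cellN B C q q) := by
  have hpt : ∀ q r : Pd k, tgtT U q r * cellT B C q r + tgtN U q r * cellN B C q r =
      sliceBeta U q r * cellN B C q r + tgtT U q r * (cellT B C q r - cellN B C q r) := by
    intro q r; rw [sliceBeta_eq_tgtT_add_tgtN]; ring
  have hdiag : (∑ q : Pd k, lamU U q * (cellT B C q q - cellN B C q q)) =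
      ∑ q : Pd k, ∑ r : Pd k, tgtT U q r * (cellT B C q r - cellN B C q r) := by
    refine Finset.sum_congr rfl fun q _ => ?_
    unfold tgtT
    rw [Finset.sum_eq_single q (fun r _ hne => by rw [if_neg (Ne.symm hne)]; ring) (fun h => absurd (mem_univ q) h), if_pos rfl]
  rw [sStarD_cylSet_eq_pair, ← pairN_sliceBeta_eq, hdiag]
  unfold pairT pairN
  rw [← Finset.sum_add_distrib, ← Finset.sum_add_distrib]
  refine Finset.sum_congr rfl fun q _ => ?_
  rw [← Finset.sum_add_distrib, ← Finset.sum_add_distrib]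
  exact Finset.sum_congr rfl fun r _ => hpt q r

/-! ### Sign structure of the coefficients -/

/-- `Θ_U ≥ 0` everywhere as soon as no totally distinct pair outside `U` has its third point in `U` ("`U^c` is third-closed"). [this work] -/
theorem thetaVal_nonneg_of_thirdClosed {U : Finset (Pd k)}
    (h : ∀ q r : Pd k, TotDist q r = true → q ∉ U → r ∉ U → thirdPt q r ∉ U) (q r : Pd k) : 0 ≤ thetaVal U q r := by
  unfold thetaVal
  by_cases hqr : TotDist q r = true
  · rw [if_pos hqr]
    unfold ind
    by_cases hq : q ∈ U
    · rw [if_pos hq]; split_ifs <;> norm_num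
    · rw [if_neg hq]
      by_cases hr : r ∈ U
      · rw [if_pos hr]; split_ifs <;> norm_num
      · rw [if_neg hr, if_neg (h q r hqr hq hr)]; norm_num
  · rw [if_neg hqr]

/-- For a cell outside `U`, `λ_U(q) = −ν_U(q) ≤ 0`; for a cell in `U`, `λ_U(q) ≥ 2^{k+1} − 2^k ≥ 0` is not needed here — we only record
`λ_U(q) < 0 → q ∉ U`. [this work] -/
theorem not_mem_of_lamU_neg {U : Finset (Pd k)} {q : Pd k} (h : lamU U q < 0) : q ∉ U := by
  intro hq
  unfold lamU at h
  unfold ind at h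
  rw [if_pos hq] at h
  have hν : (nuCount U q : ℤ) ≤ 2 ^ k := by
    unfold nuCount
    have h1 : ((U.filter fun p => TotDist p q = true).card : ℤ) ≤ ((univ.filter fun p : Pd k => TotDist p q = true).card : ℤ) := by
      exact_mod_cast Finset.card_le_card (Finset.filter_subset_filter _ (Finset.subset_univ U))
    have h2 : ((univ.filter fun p : Pd k => TotDist p q = true).card : ℤ) = 2 ^ k := by
      rw [← sum_ite_totDist_eq_pow q, Finset.sum_boole]
    rw [h2] at h1
    exact h1
  have h2k : (0:ℤ) < 2 ^ k := pow_pos (by norm_num) k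
  linarith

/-! ### The Θ-nonnegative lift and the quantitative lower bounds -/

/-- **Θ-NONNEGATIVE LIFT** (every `k`, `n`): a first slot `U ⊆ [3]^k` that is good in dimension `k` and has `Θ_U ≥ 0` is good in every
dimension: `0 ≤ sStarD (U × [3]^n) B C` for all up-sets `B, C ⊆ [3]^{n+k}`. [this work] -/
theorem sStarD_cylSet_nonneg_of_thetaVal_nonneg {U : Finset (Pd k)}
    (hU : ∀ X Y : Finset (Pd k), IsUpperSet (X : Set (Pd k)) → IsUpperSet (Y : Set (Pd k)) → 0 ≤ sStarD U X Y)
    (hΘ : ∀ q r : Pd k, 0 ≤ thetaVal U q r)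
    {B C : Finset (Pd (n + k))} (hB : IsUpperSet (B : Set (Pd (n + k)))) (hC : IsUpperSet (C : Set (Pd (n + k)))) :
    0 ≤ sStarD (cylSet U : Finset (Pd (n + k))) B C := by
  rw [sStarD_cylSet_eq_sameFibre]
  refine add_nonneg (mul_nonneg (pow_nonneg (by norm_num) n)
    (Finset.sum_nonneg fun ξ _ => hU _ _ (isUpperSet_sect hB ξ) (isUpperSet_sect hC ξ))) ?_
  exact Finset.sum_nonneg fun q _ => Finset.sum_nonneg fun r _ =>
    mul_nonneg (hΘ q r) (sub_nonneg.2 (cellN_le_cellT hB hC q r))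

/-- **Θ-NONNEGATIVE LIFT, combinatorial hypothesis**: if `U` is good in dimension `k` and no totally distinct pair of cells outside `U` has its
third point in `U`, then `U × [3]^n` is a good first slot of `[3]^{n+k}` for every `n`. [this work] -/
theorem sStarD_cylSet_nonneg_of_thirdClosed {U : Finset (Pd k)}
    (hU : ∀ X Y : Finset (Pd k), IsUpperSet (X : Set (Pd k)) → IsUpperSet (Y : Set (Pd k)) → 0 ≤ sStarD U X Y)
    (h3 : ∀ q r : Pd k, TotDist q r = true → q ∉ U → r ∉ U → thirdPt q r ∉ U)
    {B C : Finset (Pd (n + k))} (hB : IsUpperSet (B : Set (Pd (n + k)))) (hC : IsUpperSet (C : Set (Pd (n + k)))) :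
    0 ≤ sStarD (cylSet U : Finset (Pd (n + k))) B C :=
  sStarD_cylSet_nonneg_of_thetaVal_nonneg hU (thetaVal_nonneg_of_thirdClosed h3) hB hC

/-- **Θ-nonnegative lift from `PatternPos k`**: under `PatternPos k`, every up-set `U ⊆ [3]^k` whose complement is third-closed is a good first slot
`U × [3]^n` in every dimension (for `k = 4` e.g. `{x : at least two nonzero coordinates}`; `PatternPos 4` does not by itself give anything in
dimension `4 + n`). [this work] -/
theorem sStarD_cylSet_nonneg_of_patternPos_of_thirdClosed (hP : PatternPos k) {U : Finset (Pd k)} (hUup : IsUpperSet (U : Set (Pd k)))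
    (h3 : ∀ q r : Pd k, TotDist q r = true → q ∉ U → r ∉ U → thirdPt q r ∉ U)
    {B C : Finset (Pd (n + k))} (hB : IsUpperSet (B : Set (Pd (n + k)))) (hC : IsUpperSet (C : Set (Pd (n + k)))) :
    0 ≤ sStarD (cylSet U : Finset (Pd (n + k))) B C :=
  sStarD_cylSet_nonneg_of_thirdClosed (fun X Y hX hY => hP U X Y hUup hX hY) h3 hB hC

/-- **Lower bound through the negative `Θ`-cells**: for a good `U` and up-sets `B, C`,
`sStarD (cylSet U) B C ≥ Σ_{q,r : Θ_U(q,r) < 0} Θ_U(q,r)·(cellT − cellN)(q,r)`. [this work] -/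
theorem sStarD_cylSet_ge_thetaNeg {U : Finset (Pd k)}
    (hU : ∀ X Y : Finset (Pd k), IsUpperSet (X : Set (Pd k)) → IsUpperSet (Y : Set (Pd k)) → 0 ≤ sStarD U X Y)
    {B C : Finset (Pd (n + k))} (hB : IsUpperSet (B : Set (Pd (n + k)))) (hC : IsUpperSet (C : Set (Pd (n + k)))) :
    (∑ q : Pd k, ∑ r : Pd k, (if thetaVal U q r < 0 then thetaVal U q r * (cellT B C q r - cellN B C q r) else 0))
      ≤ sStarD (cylSet U : Finset (Pd (n + k))) B C := by
  rw [sStarD_cylSet_eq_sameFibre]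
  have h1 : (0:ℤ) ≤ 2 ^ n * (∑ ξ : Pd n, sStarD U (sect B ξ) (sect C ξ)) :=
    mul_nonneg (pow_nonneg (by norm_num) n) (Finset.sum_nonneg fun ξ _ => hU _ _ (isUpperSet_sect hB ξ) (isUpperSet_sect hC ξ))
  have h2 : (∑ q : Pd k, ∑ r : Pd k, (if thetaVal U q r < 0 then thetaVal U q r * (cellT B C q r - cellN B C q r) else 0))
      ≤ ∑ q : Pd k, ∑ r : Pd k, thetaVal U q r * (cellT B C q r - cellN B C q r) := by
    refine Finset.sum_le_sum fun q _ => Finset.sum_le_sum fun r _ => ?_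
    have hH : 0 ≤ cellT B C q r - cellN B C q r := sub_nonneg.2 (cellN_le_cellT hB hC q r)
    split_ifs with hneg
    · exact le_rfl
    · exact mul_nonneg (not_lt.1 hneg) hH
  linarith

/-- **Lower bound through the cells outside `U`**: for a good `U` and up-sets `B, C`,
`sStarD (cylSet U) B C ≥ Σ_{q : λ_U(q) < 0} λ_U(q)·(cellT − cellN)(q,q)` (and `λ_U(q) < 0` only for `q ∉ U`, where `λ_U(q) = −ν_U(q)`). [this work] -/
theorem sStarD_cylSet_ge_lamNeg {U : Finset (Pd k)}
    (hU : ∀ X Y : Finset (Pd k), IsUpperSet (X : Set (Pd k)) → IsUpperSet (Y : Set (Pd k)) → 0 ≤ sStarD U X Y)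
    {B C : Finset (Pd (n + k))} (hB : IsUpperSet (B : Set (Pd (n + k)))) (hC : IsUpperSet (C : Set (Pd (n + k)))) :
    (∑ q : Pd k, (if lamU U q < 0 then lamU U q * (cellT B C q q - cellN B C q q) else 0))
      ≤ sStarD (cylSet U : Finset (Pd (n + k))) B C := by
  rw [sStarD_cylSet_eq_crossFibre]
  have h1 : (0:ℤ) ≤ ∑ ξ : Pd n, ∑ η : Pd n, (if TotDist ξ η = true then (1:ℤ) else 0) * sStarD U (sect B ξ) (sect C η) :=
    Finset.sum_nonneg fun ξ _ => Finset.sum_nonneg fun η _ =>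
      mul_nonneg (by split_ifs <;> norm_num) (hU _ _ (isUpperSet_sect hB ξ) (isUpperSet_sect hC η))
  have h2 : (∑ q : Pd k, (if lamU U q < 0 then lamU U q * (cellT B C q q - cellN B C q q) else 0))
      ≤ ∑ q : Pd k, lamU U q * (cellT B C q q - cellN B C q q) := by
    refine Finset.sum_le_sum fun q _ => ?_
    have hH : 0 ≤ cellT B C q q - cellN B C q q := sub_nonneg.2 (cellN_le_cellT hB hC q q)
    split_ifs with hneg
    · exact le_rfl
    · exact mul_nonneg (not_lt.1 hneg) hH
  linarith

end Summit.CriticalPhenomena.PercolationContinuityZ3.Theorems.SahiGridPattern
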